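import Summits.ResolutionOfSingularities.ResolutionOfSingularities.Theorems.FrobeniusClosingSteerJacobianThinness
import Summits.ResolutionOfSingularities.ResolutionOfSingularities.Theorems.FrobeniusClosingSteerCylinderConcl

/-!
# Crux `Steer` (stmt-ResolutionOfSingularities-16345), line `switching-dichotomy` — WORDS 01: the consequent by prime, the
vocabulary of the dichotomy, torsor runs (HOIST of the registered skeleton r31 727d9e199382098a, l.248–421)

Holder res-L0-w41-lead-1 g4 on chain planner res-L0-w41-plan-1 g9's RULING 47 (E1): the FROZEN words of the crux skeleton
(byte-unchanged since r24) are hoisted VERBATIM into Theses-free tree modules `…Theorems.SwitchingDichotomy.Words`, so that the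
closing file of the crux can be «imports + `Steer_proof`» (the gate's 400-line cap) and hands import the words instead of re-declaring
them. RULING 47b (no duplicate hoists): the words a hand already landed VERBATIM are EXPORTED from their tree homes, not re-declared —
`Concl`, `IsExcParam`, `IsStrictStep`, `IsTorsorRunUpTo`, `IsTorsorRun` (`…Theorems.SteerRankThinness`, p493665 / JacobianThinness) and
`ZeroDim`, `TorsorLUZeroDimBelow` (`…Theorems.SteerCylinder`); the skeleton's sanity lemma `exists_trdeg_eq_nat` is the tree's
`…Theorems.SwitchingDichotomy.exists_nat_trdeg_eq` (p-DefectCore) and is not re-hoisted. Everything else below is the skeleton's text byte for byte (docstrings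
included); nothing here is a statement of the manuscript [claim: Hironaka2017, status: under-review]. OURS (candidates / vocabulary;
AI review is weaker than expert review).
-/

open Literature.AlgebraicGeometry.Resolution (IsAbhyankarPlace FGOver exists_ringKrullDim_eq_and_trdeg_eq
  trdeg_eq_trdeg_of_isFractionRing locAtCentre IsQuadraticTransformAlong SubringDominates IsRsopPart)

set_option linter.dupNamespace false

namespace Summit.ResolutionOfSingularities.ResolutionOfSingularities.Theorems.SwitchingDichotomy.Words

export Summit.ResolutionOfSingularities.ResolutionOfSingularities.Theorems.SteerRankThinness
  (Concl IsExcParam IsStrictStep IsTorsorRunUpTo IsTorsorRun)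
export Summit.ResolutionOfSingularities.ResolutionOfSingularities.Theorems.SteerCylinder (ZeroDim TorsorLUZeroDimBelow)

/-! ## The consequent of the crux, prime by prime (verbatim line `birth`) -/

/-- Torsor LU over perfect ground fields of characteristic `p` — verbatim the consequent of `Steer`
at `p` (= body of `TorsorLUPerfect`, stmt-16158). [cite: Temkin2013, Rem. 1.3.5] -/
def TorsorLU (p : ℕ) : Prop :=
  ∀ (k K : Type) [Field k] [CharP k p] [PerfectField k] [Field K] [Algebra k K]
    (O : ValuationSubring K) (A₀ : Subalgebra k K) (h₀ : A₀.toSubring ≤ O.toSubring) (t : K),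
    A₀.FG → t ^ p ∈ A₀ → IsFractionRing (Algebra.adjoin k (insert t (A₀ : Set K))) K →
    IsRegularLocalRing (Localization.AtPrime
      (Ideal.comap (Subring.inclusion h₀) (IsLocalRing.maximalIdeal O))) →
    ∃ (A : Subalgebra k K) (h : A.toSubring ≤ O.toSubring), A₀ ≤ A ∧ t ∈ A ∧ A.FG ∧
      IsFractionRing A K ∧ IsRegularLocalRing (Localization.AtPrime
        (Ideal.comap (Subring.inclusion h) (IsLocalRing.maximalIdeal O)))

/-- The same at ZERO-DIMENSIONAL valuation rings (residue field algebraic over `k`), typed as in the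
tree's `relLU_of_relLU_zeroDim` and line `birth`. [cite: ZariskiSamuel1960, Ch. VI §17] -/
def TorsorLUZeroDim (p : ℕ) : Prop :=
  ∀ (k K : Type) [Field k] [CharP k p] [PerfectField k] [Field K] [Algebra k K]
    (O : ValuationSubring K) (A₀ : Subalgebra k K) (h₀ : A₀.toSubring ≤ O.toSubring) (t : K),
    (∀ x ∈ O, ∃ f : Polynomial k, f ≠ 0 ∧ Polynomial.aeval x f ∈ O.nonunits) →
    A₀.FG → t ^ p ∈ A₀ → IsFractionRing (Algebra.adjoin k (insert t (A₀ : Set K))) K →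
    IsRegularLocalRing (Localization.AtPrime
      (Ideal.comap (Subring.inclusion h₀) (IsLocalRing.maximalIdeal O))) →
    ∃ (A : Subalgebra k K) (h : A.toSubring ≤ O.toSubring), A₀ ≤ A ∧ t ∈ A ∧ A.FG ∧
      IsFractionRing A K ∧ IsRegularLocalRing (Localization.AtPrime
        (Ideal.comap (Subring.inclusion h) (IsLocalRing.maximalIdeal O)))

/-! ## Vocabulary of the dichotomy (all over existing declarations) -/

section Vocabulary

variable {k K : Type} [Field k] [Field K] [Algebra k K]

/-- `O` is discrete of rank one (typed as in the landed `luAlphaPTorsor_of_discrete`). -/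
def Discrete (O : ValuationSubring K) : Prop :=
  ∃ π : K, π ≠ 0 ∧ O.valuation π < 1 ∧ ∀ z : K, z ≠ 0 → ∃ n : ℤ, O.valuation z = O.valuation π ^ n

variable (k) in
/-- `K` is DENSE (for `v`) in a finitely generated subfield `F₀ ⊇ k` on which `O` is an Abhyankar place
— the hypothesis of the parent crux's landed dense-Abhyankar range `denseRange3_crux`
(Knaf–Kuhlmann 2009, Thm. 1.5). [cite: KnafKuhlmann2009, Thm. 1.5] -/
def DenseAbhyankar (O : ValuationSubring K) : Prop :=
  ∃ F₀ : Subfield K, (algebraMap k K).fieldRange ≤ F₀ ∧ FGOver (algebraMap k K).fieldRange F₀ ∧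
    IsAbhyankarPlace O (algebraMap k K).fieldRange F₀ ∧
    ∀ x w : K, w ≠ 0 → ∃ a ∈ F₀, O.valuation (x - a) < O.valuation w

/-- `x` is a fraction of elements of `A₀` (i.e. `x ∈ Frac A₀ ⊆ K`). -/
def IsFracOf (A₀ : Subalgebra k K) (x : K) : Prop :=
  ∃ y ∈ A₀, ∃ z ∈ A₀, z ≠ 0 ∧ x = y / z

/-- **Strongly switching (Shannon 1973; Granja 2004; HLOST 2017, Discussion 4.2).** The quadratic
sequence `R 0 = (A₀)_{𝔪_O ∩ A₀} ⊂ R 1 ⊂ ⋯` of the base along `O` EXHAUSTS `O ∩ Frac A₀`: every element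
of `O` that is a fraction of elements of `A₀` lies in some `R i` — i.e. the Shannon extension `⋃ R i` is
the valuation ring `O ∩ Frac A₀`. By Shannon / Granja this is the union of the rank-one case ("switches
strongly infinitely often") and the height-one-directed rank-two case.
[cite: HeinzerEtAl2015, Discussion 4.2 and Remark 2.4; Shannon1973] -/
def StronglySwitching (O : ValuationSubring K) (A₀ : Subalgebra k K) : Prop :=
  ∀ R : ℕ → Subring K, R 0 = locAtCentre A₀.toSubring O →
    (∀ i, IsQuadraticTransformAlong O (R i) (R (i + 1))) →
    ∀ x : K, x ∈ O → IsFracOf A₀ x → ∃ i, x ∈ R i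

/-- **Parameter-archimedean along the quadratic sequence** (lead reshape r4): every non-zero fraction
`y` of `A₀` of positive value is dominated by a power of a one-element part of a regular system of
parameters of SOME member `R i` of the quadratic sequence of the base along `O`: `v((z 0) ^ n) < v(y)`.
Holds in rank one (`Theorems.SwitchingDichotomy.archSeq_of_arch`) and for height-one-directed sequences
along an EXCEPTIONAL prime divisor. [cite: HeinzerEtAl2015, Remark 2.4] [folklore] -/
def ArchSeq (O : ValuationSubring K) (A₀ : Subalgebra k K) : Prop :=
  ∀ R : ℕ → Subring K, R 0 = locAtCentre A₀.toSubring O →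
    (∀ i, IsQuadraticTransformAlong O (R i) (R (i + 1))) →
    ∀ y : K, IsFracOf A₀ y → y ≠ 0 → O.valuation y < 1 →
      ∃ (i : ℕ) (_ : IsLocalRing (R i)) (z : Fin 1 → R i), IsRsopPart z ∧
        ∃ n : ℕ, O.valuation ((z 0 : R i) : K) ^ n < O.valuation y

/-- **Defect** of the datum: the radicand `t ^ p` has NO `p`-th-power approximation from `Frac A₀`
whose error has value outside the values of `p`-th powers of `Frac A₀`.
[cite: Kuhlmann2010ArtinSchreier, §2] -/
def Defect (O : ValuationSubring K) (A₀ : Subalgebra k K) (t : K) (p : ℕ) : Prop :=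
  ∀ g : K, IsFracOf A₀ g → ∃ w : K, IsFracOf A₀ w ∧ O.valuation (t ^ p - g ^ p) = O.valuation (w ^ p)

end Vocabulary

/-! ## r8 vocabulary (W4.1, the C2 cut): torsor runs along the quadratic sequence

All over existing declarations (`Subring`, `ValuationSubring.valuation`, `Derivation`, `IsRsopPart`); the
centre of `O` on a member `S = R i` of the quadratic sequence is `{y ∈ S | O.valuation y < 1}` (the members
are dominated by `O`, `stub_switchingSetup`), so no `IsLocalRing` instance has to be threaded. -/

section TorsorRun

variable {K : Type} [Field K]

/-- The run CAN STEP at stage `N`: some strict-transform step from `s N` lands with `p`-th power in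
`R (N + 1)` — equivalently (for `R N` regular and `R (N + 1)` its quadratic transform along `O`) the
radicand `(s N) ^ p` has order `≥ p` after subtracting a suitable `p`-th power `g ^ p`, `g ∈ R N`: the typed
`MultP` of `IsolatedForcedTermination`. [folklore] -/
def CanStep (O : ValuationSubring K) (R : ℕ → Subring K) (p : ℕ) (s : ℕ → K) (N : ℕ) : Prop :=
  ∃ s' : K, IsStrictStep O (R N) (s N) s' ∧ s' ^ p ∈ R (N + 1)

/-- The ORDER-ONE FORM at stage `N` (the exit): after cleaning, `(s N) ^ p - g ^ p` is a regular parameter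
of `R N` (a one-element part of a regular system of parameters), so that `R N [s N]` is regular.
[cite: HeinzerEtAl2015, Prop. 4.4] [folklore] -/
def OrderOneAt (R : ℕ → Subring K) (p : ℕ) (s : ℕ → K) (N : ℕ) : Prop :=
  ∃ g ∈ R N, ∃ (_ : IsLocalRing (R N)) (z : Fin 1 → R N), IsRsopPart z ∧
    ((z 0 : R N) : K) = s N ^ p - g ^ p

/-- ISOLATED at `S ∋ f`: the Jacobian ideal `⟨δ f | δ : Der_ℤ(S, S)⟩` contains a power of every element of
the centre of `O` on `S` (it is primary to the centre, or all of `S`). For `S` regular, essentially of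
finite type over a perfect field, with algebraic residue field, this is the typed `Isol` of
`IsolatedForcedTermination` read in Cohen coordinates (`Der_ℤ S` is free on the partial derivatives).
Invariant under the torsor gauge `f ↦ w ^ p * f + g ^ p` (`w` a unit). [cite: HauserPerlega2019, §3] [folklore] -/
def IsolAt (O : ValuationSubring K) (S : Subring K) (f : K) : Prop :=
  ∃ (hf : f ∈ S) (N : ℕ), ∀ y : S, O.valuation (y : K) < 1 →
    y ^ N ∈ Ideal.span (Set.range fun δ : Derivation ℤ S S => δ ⟨f, hf⟩)

end TorsorRun

end Summit.ResolutionOfSingularities.ResolutionOfSingularities.Theorems.SwitchingDichotomy.Words
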